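import Mathlib
import Literature.MathematicalPhysics.QuantumFieldTheory.Balaban1983to89.Beta.VectorTailsPt

/-!
# (W3a)₀ vector road, node VECTOR-TAILS-PROP12 — THE CYCLIC BLOCK INSTANCE of the volume seam:
# base points `b ∈ [0,n)⁴ ⊂ ℤ⁴` (optionally labelled), the cyclic shift by `e_μ` inside the block,
# and the discharge of the instance hypotheses of `VectorTailsPt.wall_rows_mod`; with the proof that
# the STRICT shift of `VectorTailsPt.wall_rows` allows no nonempty finite invariant block

HONEST FRAMING (verbatim, binding for this lineage).  «discharging `BetaPertH` makes Bałaban's UV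
stability UNCONDITIONAL — a real constructive-QFT result; it is NOT the continuum limit and NOT the
Clay problem.»  ABSOLUTE RULE (verbatim).  «No internally-minted statement may enter as a cited
fact. Every hypothesis is either kernel-proved in this package or a verbatim quotation of a
PUBLISHED theorem with page reference. The manuscript(s) under audit are NOT citable for their own
disputed steps — they are the thing under adjudication; programme-internal (2001/route/tribunal)
claims are never citable.»  This file cites NOTHING: every declaration is `[folklore]` bookkeeping
about finite sets, permutations of `ℤ⁴` and the reduction `castT : ℤ⁴ → Π_μ ℤ/(n M_μ)`,
kernel-checked.  The two printed displays of B5 (T. Bałaban, Propagators and renormalization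
transformations for lattice gauge theories I, Comm. Math. Phys. 95 (1984) 17–40, pp. 35–36, 38) —
`B5.Prop12Printed`, `B5.Kernel126_127Printed` — enter ONLY as the named hypotheses `h12`, `h126`
of `rows_block`, passed unchanged to `VectorTailsPt.wall_rows_mod`, and are NEVER discharged here.

Companion of `Beta/VectorTailsPt.lean` (§7 `wall_rows`, §8 block-translation covariance of `𝒢`,
§9 `wall_rows_mod`).  There the torus-side rows `d0T / d1T / d1×T / d2×T` of the volume seam are
proved for ANY base-point type `κB`, ANY blocks `Bset : ℕ → Finset κB` and ANY relabelling
`sh : ℕ → Equiv.Perm κB` whose instance map `X₀` translates the source site by `e_μ` — strictly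
(`wall_rows`) or modulo block translations (`wall_rows_mod`).  The consumer (the average-first
scalar wall `Beta/SquareTableAvgFirst`, `sum_perm_shift` / `sum_bdry_eq_zero`, and the volume seam
of the an4 lineage) additionally needs `hshB : sh n b ∈ Bset n ↔ b ∈ Bset n` — the shift PERMUTES
each finite block.

## What this file does (all `[folklore]`, kernel-checked, no cited facts)

§1 THE STRICT SHIFT IS VACUOUS ON FINITE BLOCKS.  `strict_shift_forces_small_torus`: if a map `sh`
preserves a nonempty finite set `B` of base points and an instance map `X₀ : κB → Π_μ ℤ/N_μ`
satisfies the strict shift `X₀ (sh b) = X₀ b + e_μ` on `B`, then `N_μ ≤ |B|` (pigeonhole on the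
orbit `k ↦ sh^[k] b`, along which `X₀` advances by `k • e_μ`).  `strict_wall_hyps_force_empty`: in
the literal binder shapes of `VectorTailsPt.wall_rows` — its `hX` — and of the consumer — its
`hshB` —, volume growth `hgrow` along a proper filter forces `Bset n = ∅` for every `n ≥ 2`.  So
`wall_rows` must not be instantiated with finite invariant blocks; `wall_rows_mod` is the form to
use, and §2–§4 instantiate it.

§2 THE CYCLIC BLOCK SHIFT.  `cyc n : Equiv.Perm ℤ` is `x ↦ x + 1` on `[0,n)` with `n − 1 ↦ 0`,
the identity elsewhere; `blockShift n μ : Equiv.Perm (Fin 4 → ℤ)` applies it in coordinate `μ`;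
`block n = [0,n)⁴` (`Fintype.piFinset`).  `blockShift_mem_block_iff` (the shift permutes the
block), `block_nonempty`, `block_card : |block n| = n⁴`, and `blockShift_sub_eq`: on the block,
`sh b − (b + e_μ) = n · z` with `z ∈ {0, −e_μ}`.  LABELLED base points (§3): `κB = Pt × L` for any
label type `L` (e.g. bond directions), `lblock S n = block n ×ˢ S`, `lshift n μ = blockShift n μ × id`
(`lshift_mem_lblock_iff`, `lblock_nonempty`); labels are untouched by the shift, so component
choices `kk n b = k b.2`, `nn n b = ν₀ b.2` are `sh`-invariant by `rfl`.

§4 THE DISCHARGE AND THE ROWS.  With the instance map `X₀ (n,t) b = castT (fine n (Mv (n,t))) b.1`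
(the integer base point read in the fine torus of every volume), `lwrapped_hX`: the hypothesis
`hX` of `wall_rows_mod` holds — `X₀ (sh b) − (X₀ b + e_μ) ∈ VectorTailsPt.blockSteps` — at EVERY
scale and in EVERY volume (`VectorTailsPt.castT_blockVec_mem_blockSteps`); and `rows_block`: the
four torus-side rows `d0T / d1T / d1×T / d2×T` for this instance, i.e. `VectorTailsPt.wall_rows_mod`
applied to it, with the blocks `lblock S`, the shift `lshift`, and label-dependent components.
Together with `lshift_mem_lblock_iff` (the consumer's `hshB`) this is a COMPLETE instance of the
hypothesis set of the v1.1 seam with nonempty blocks at all scales (contrast §1).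

## What this file does NOT do

* It does not choose the wall's weights, its averaging, the functional `φ`, or the label set — any
  block-constant or `lshift`-invariant weight serves the consumer's `hwt`; those choices belong to
  the wall.
* It does not supply the volume limits `hG` of the seam, the free-comparison rows `h0T–h2×T`, or
  anything outside the faithful box; nothing here is specific to `U = 1` beyond what
  `VectorTailsPt.wall_rows_mod` already assumes.
* It does not discharge `B5.Prop12Printed` / `B5.Kernel126_127Printed`.  NOT summit progress; NOT
  the continuum limit, NOT Clay.
-/

namespace Literature.MathematicalPhysics.QuantumFieldTheory.Balaban1983to89.Beta.VectorTailsBlock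

open Literature.MathematicalPhysics.QuantumFieldTheory.Balaban1983to89.B5Prop11Plancherel
open Literature.MathematicalPhysics.QuantumFieldTheory.Balaban1983to89.Beta.VectorTails
  (castT castT_add castT_neg castT_single)
open Literature.MathematicalPhysics.QuantumFieldTheory.Balaban1983to89.Beta.VectorTailsLoc
  (fam kfam)
open Literature.MathematicalPhysics.QuantumFieldTheory.Balaban1983to89.Beta.VectorTailsPt
  (blockSteps castT_blockVec_mem_blockSteps GT wall_rows_mod)
open Filter Topology

noncomputable section

/-! ## §1 The strict shift is vacuous on a finite invariant set -/

section Strict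

variable {d : ℕ} {N : Fin d → ℕ} {κB : Type*}

/-- iterating a strict shift: the iterate stays in `B` and `X₀ (sh^[k] b) = X₀ b + k • e_μ`.
[folklore] -/
theorem iterate_mem_and_eq (B : Finset κB) (sh : κB → κB) (X₀ : κB → Tor N) (μ : Fin d)
    (hB : ∀ b ∈ B, sh b ∈ B) (hX : ∀ b ∈ B, X₀ (sh b) = X₀ b + unitVec N μ)
    {b : κB} (hb : b ∈ B) (k : ℕ) :
    sh^[k] b ∈ B ∧ X₀ (sh^[k] b) = X₀ b + k • unitVec N μ := by
  induction k with
  | zero => simp [hb]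
  | succ k ih =>
    rw [Function.iterate_succ_apply', add_smul, one_smul, ← add_assoc]
    exact ⟨hB _ ih.1, by rw [hX _ ih.1, ih.2]⟩

/-- **a strict shift on a nonempty finite invariant set forces a small torus: `N_μ ≤ |B|`.**
[folklore] -/
theorem strict_shift_forces_small_torus (B : Finset κB) (sh : κB → κB) (X₀ : κB → Tor N)
    (μ : Fin d) (hB : ∀ b ∈ B, sh b ∈ B) (hX : ∀ b ∈ B, X₀ (sh b) = X₀ b + unitVec N μ)
    (hne : B.Nonempty) : N μ ≤ B.card := by
  obtain ⟨b, hb⟩ := hne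
  have hmaps : ∀ k ∈ Finset.range (B.card + 1), sh^[k] b ∈ B := fun k _ =>
    (iterate_mem_and_eq B sh X₀ μ hB hX hb k).1
  have hcard : B.card < (Finset.range (B.card + 1)).card := by simp
  obtain ⟨i, hi, j, hj, hne, heq⟩ := Finset.exists_ne_map_eq_of_card_lt_of_maps_to hcard hmaps
  have hij : (i : ZMod (N μ)) = (j : ZMod (N μ)) := by
    have h1 := (iterate_mem_and_eq B sh X₀ μ hB hX hb i).2
    have h2 := (iterate_mem_and_eq B sh X₀ μ hB hX hb j).2
    rw [heq] at h1
    have h := congr_fun (add_left_cancel (h1.symm.trans h2)) μ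
    simpa [unitVec, nsmul_eq_mul] using h
  have hmod : i ≡ j [MOD N μ] := (ZMod.natCast_eq_natCast_iff i j (N μ)).1 hij
  simp only [Finset.mem_range] at hi hj
  rcases Nat.lt_or_gt_of_ne hne with h | h
  · have hd : N μ ∣ j - i := (Nat.modEq_iff_dvd' h.le).1 hmod
    have := Nat.le_of_dvd (by omega) hd
    omega
  · have hd : N μ ∣ i - j := (Nat.modEq_iff_dvd' h.le).1 hmod.symm
    have := Nat.le_of_dvd (by omega) hd
    omega

/-- **IN THE WALL'S LITERAL SHAPES: the hypotheses `hX` of `VectorTailsPt.wall_rows` and `hshB`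
of the consumer, under volume growth `hgrow` along a proper filter, force `Bset n = ∅` for every
`n ≥ 2`** — every row of the strict seam then quantifies over the empty set.  [folklore] -/
theorem strict_wall_hyps_force_empty {τ : Type} {κB' : Type*} (Mv : ℕ+ × τ → Fin 4 → ℕ)
    {l : Filter τ} [l.NeBot]
    (hgrow : ∀ (m : ℕ+) (ρ : Fin 4), Tendsto (fun t => (m : ℕ) * Mv (m, t) ρ) l atTop)
    (X₀ : (i : ℕ+ × τ) → κB' → Tor (fine ((i.1 : ℕ+) : ℕ) (Mv i)))
    (Bset : ℕ → Finset κB') (sh : ℕ → Equiv.Perm κB') {μ : Fin 4}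
    (hX : ∀ (m : ℕ+) (t : τ), ∀ b ∈ Bset m,
      X₀ (m, t) (sh m b) = X₀ (m, t) b + unitVec (fine (m : ℕ) (Mv (m, t))) μ)
    (hshB : ∀ n : ℕ, 2 ≤ n → ∀ b, sh n b ∈ Bset n ↔ b ∈ Bset n) :
    ∀ n : ℕ, 2 ≤ n → Bset n = ∅ := by
  intro n hn
  by_contra hne
  have hne' : (Bset n).Nonempty := Finset.nonempty_iff_ne_empty.2 hne
  let m : ℕ+ := ⟨n, by omega⟩
  obtain ⟨t, ht⟩ := ((hgrow m μ).eventually (eventually_gt_atTop (Bset n).card)).exists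
  have hle : fine (m : ℕ) (Mv (m, t)) μ ≤ (Bset n).card :=
    strict_shift_forces_small_torus (Bset n) (sh n) (X₀ (m, t)) μ
      (fun b hb => (hshB n hn b).2 hb) (hX m t) hne'
  have hfine : fine (m : ℕ) (Mv (m, t)) μ = (m : ℕ) * Mv (m, t) μ := rfl
  rw [hfine] at hle
  exact absurd (lt_of_lt_of_le ht hle) (lt_irrefl _)

end Strict

/-! ## §2 The cyclic block shift -/

section Block

/-- the cyclic shift `x ↦ x + 1` on `[0,n) ⊂ ℤ` (wrapping `n − 1 ↦ 0`), identity elsewhere.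
[folklore] -/
def cycFun (n : ℕ) (x : ℤ) : ℤ :=
  if 0 ≤ x ∧ x < n then (if x + 1 = n then 0 else x + 1) else x

/-- its inverse `x ↦ x − 1` on `[0,n)` (wrapping `0 ↦ n − 1`).  [folklore] -/
def cycInv (n : ℕ) (x : ℤ) : ℤ :=
  if 0 ≤ x ∧ x < n then (if x = 0 then (n : ℤ) - 1 else x - 1) else x

/-- left inverse.  [folklore] -/
theorem cycInv_cycFun (n : ℕ) (x : ℤ) : cycInv n (cycFun n x) = x := by
  unfold cycFun cycInv
  split_ifs <;> omega

/-- right inverse.  [folklore] -/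
theorem cycFun_cycInv (n : ℕ) (x : ℤ) : cycFun n (cycInv n x) = x := by
  unfold cycFun cycInv
  split_ifs <;> omega

/-- the cyclic shift as a permutation of `ℤ`.  [folklore] -/
def cyc (n : ℕ) : Equiv.Perm ℤ :=
  ⟨cycFun n, cycInv n, cycInv_cycFun n, cycFun_cycInv n⟩

/-- unfolding lemma.  [folklore] -/
theorem cyc_apply (n : ℕ) (x : ℤ) : cyc n x = cycFun n x := rfl

/-- `cyc n` preserves `[0,n)` and its complement.  [folklore] -/
theorem cyc_mem_iff (n : ℕ) (x : ℤ) : (0 ≤ cyc n x ∧ cyc n x < n) ↔ (0 ≤ x ∧ x < n) := by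
  rw [cyc_apply]
  unfold cycFun
  split_ifs <;> omega

/-- on `[0,n)`: `cyc n x − (x + 1) = n · (wrap indicator)`, the indicator being `−1` at `x = n − 1`
and `0` otherwise.  [folklore] -/
theorem cyc_sub (n : ℕ) {x : ℤ} (h : 0 ≤ x ∧ x < n) :
    cyc n x - (x + 1) = (n : ℤ) * (if x + 1 = n then -1 else 0) := by
  rw [cyc_apply]
  unfold cycFun
  rw [if_pos h]
  split_ifs <;> omega

/-- the block shift: `cyc n` in coordinate `μ`, identity in the other coordinates.  [folklore] -/
def blockShift (n : ℕ) (μ : Fin 4) : Equiv.Perm DyadicShell.Pt :=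
  Equiv.piCongrRight fun a => if a = μ then cyc n else Equiv.refl ℤ

/-- coordinates of the block shift.  [folklore] -/
theorem blockShift_apply (n : ℕ) (μ : Fin 4) (b : DyadicShell.Pt) (a : Fin 4) :
    blockShift n μ b a = if a = μ then cyc n (b a) else b a := by
  change (if a = μ then cyc n else Equiv.refl ℤ) (b a) = _
  split_ifs <;> rfl

/-- the block `[0,n)⁴ ⊂ ℤ⁴`.  [folklore] -/
def block (n : ℕ) : Finset DyadicShell.Pt := Fintype.piFinset fun _ => Finset.Ico (0 : ℤ) n

/-- membership in the block.  [folklore] -/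
theorem mem_block (n : ℕ) (b : DyadicShell.Pt) : b ∈ block n ↔ ∀ a, 0 ≤ b a ∧ b a < n := by
  simp [block, Fintype.mem_piFinset]

/-- **the block shift PERMUTES the block** (the consumer's `hshB`, at every scale).  [folklore] -/
theorem blockShift_mem_block_iff (n : ℕ) (μ : Fin 4) (b : DyadicShell.Pt) :
    blockShift n μ b ∈ block n ↔ b ∈ block n := by
  rw [mem_block, mem_block]
  refine forall_congr' fun a => ?_
  rw [blockShift_apply]
  split_ifs
  · exact cyc_mem_iff n (b a)
  · exact Iff.rfl

/-- the blocks are nonempty (`n ≥ 1`).  [folklore] -/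
theorem block_nonempty (n : ℕ) (hn : 1 ≤ n) : (block n).Nonempty :=
  ⟨0, (mem_block n 0).2 fun _ => ⟨le_rfl, by simp only [Pi.zero_apply]; omega⟩⟩

/-- `|block n| = n⁴`.  [folklore] -/
theorem block_card (n : ℕ) : (block n).card = n ^ 4 := by
  simp [block, Fintype.card_piFinset]

/-- on the block, `sh b − (b + e_μ)` is `n` times an integer vector (`0`, or `−e_μ` at the wrap
points `b_μ = n − 1`).  [folklore] -/
theorem blockShift_sub_eq (n : ℕ) (μ : Fin 4) {b : DyadicShell.Pt} (hb : b ∈ block n) :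
    (blockShift n μ b : DyadicShell.Pt) - (b + Pi.single μ 1) =
      fun a => (n : ℤ) * (if a = μ then (if b μ + 1 = n then -1 else 0) else 0) := by
  funext a
  simp only [Pi.sub_apply, Pi.add_apply, blockShift_apply]
  by_cases ha : a = μ
  · subst ha
    simp only [if_true, Pi.single_eq_same]
    exact cyc_sub n ((mem_block n b).1 hb a)
  · simp [ha]

end Block

/-! ## §3 Labelled base points `κB = Pt × L` -/

section Labelled

variable {L : Type*}

/-- labelled blocks `[0,n)⁴ × S`.  [folklore] -/
def lblock (S : Finset L) (n : ℕ) : Finset (DyadicShell.Pt × L) := block n ×ˢ S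

/-- the labelled shift: the block shift on the point, the identity on the label.  [folklore] -/
def lshift (n : ℕ) (μ : Fin 4) : Equiv.Perm (DyadicShell.Pt × L) :=
  Equiv.prodCongr (blockShift n μ) (Equiv.refl L)

/-- components of the labelled shift.  [folklore] -/
theorem lshift_apply (n : ℕ) (μ : Fin 4) (b : DyadicShell.Pt × L) :
    lshift n μ b = (blockShift n μ b.1, b.2) := rfl

/-- **the labelled shift PERMUTES each labelled block** (the consumer's `hshB`).  [folklore] -/
theorem lshift_mem_lblock_iff (S : Finset L) (n : ℕ) (μ : Fin 4) (b : DyadicShell.Pt × L) :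
    lshift n μ b ∈ lblock S n ↔ b ∈ lblock S n := by
  simp only [lblock, lshift_apply, Finset.mem_product, blockShift_mem_block_iff]

/-- labelled blocks are nonempty (`n ≥ 1`, `S` nonempty).  [folklore] -/
theorem lblock_nonempty {S : Finset L} (hS : S.Nonempty) (n : ℕ) (hn : 1 ≤ n) :
    (lblock S n).Nonempty :=
  Finset.Nonempty.product (block_nonempty n hn) hS

/-- `|lblock S n| = n⁴ |S|`.  [folklore] -/
theorem lblock_card (S : Finset L) (n : ℕ) : (lblock S n).card = n ^ 4 * S.card := by
  rw [lblock, Finset.card_product, block_card]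

end Labelled

/-! ## §4 The discharge of the instance hypotheses of `wall_rows_mod`, and the rows -/

section Discharge

/-- `castT` is subtractive.  [folklore] -/
theorem castT_sub {d : ℕ} (N : Fin d → ℕ) (v w : Fin d → ℤ) :
    castT N (v - w) = castT N v - castT N w := by
  rw [sub_eq_add_neg, castT_add, castT_neg, ← sub_eq_add_neg]

/-- **the wrapped shift hypothesis for integer base points**: for `X₀ = castT` (sites of `ℤ⁴`
reduced to the fine torus of the volume) and the cyclic block shift, `X₀ (sh b) − (X₀ b + e_μ)` is a
block translation — at EVERY scale `m` and in EVERY volume `t`.  [folklore] -/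
theorem wrapped_hX {τ : Type} (Mv : ℕ+ × τ → Fin 4 → ℕ) (μ : Fin 4) :
    ∀ (m : ℕ+) (t : τ), ∀ b ∈ block m,
      castT (fine ((m : ℕ+) : ℕ) (Mv (m, t))) (blockShift m μ b) -
          (castT (fine ((m : ℕ+) : ℕ) (Mv (m, t))) b + unitVec (fine (m : ℕ) (Mv (m, t))) μ)
        ∈ blockSteps (m : ℕ) (Mv (m, t)) := by
  intro m t b hb
  rw [show unitVec (fine (m : ℕ) (Mv (m, t))) μ
      = castT (fine ((m : ℕ+) : ℕ) (Mv (m, t))) (Pi.single μ 1) from (castT_single _ μ).symm,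
    ← castT_add, ← castT_sub, blockShift_sub_eq (m : ℕ) μ hb]
  exact castT_blockVec_mem_blockSteps (m : ℕ) (Mv (m, t)) _

variable {τ : Type} {L : Type*} (Mv : ℕ+ × τ → Fin 4 → ℕ) [hMv : ∀ i ρ, NeZero (Mv i ρ)]
  (a : ℝ) (ha : 0 < a)

/-- THE INSTANCE MAP of the labelled block instance: the integer base point read in the fine torus
of the volume, `X₀ (n,t) (b, ℓ) = castT (fine n (Mv (n,t))) b`.  [folklore] -/
def X₀L : (i : ℕ+ × τ) → DyadicShell.Pt × L → Tor (fine ((i.1 : ℕ+) : ℕ) (Mv i)) :=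
  fun i b => castT (fine ((i.1 : ℕ+) : ℕ) (Mv i)) b.1

omit hMv in
/-- **the hypothesis `hX` of `VectorTailsPt.wall_rows_mod` HOLDS for the labelled block instance.**
[folklore] -/
theorem lwrapped_hX (S : Finset L) (μ : Fin 4) :
    ∀ (m : ℕ+) (t : τ), ∀ b ∈ lblock S m,
      X₀L Mv (m, t) (lshift m μ b) - (X₀L Mv (m, t) b + unitVec (fine (m : ℕ) (Mv (m, t))) μ)
        ∈ blockSteps (m : ℕ) (Mv (m, t)) := by
  intro m t b hb
  rw [lblock, Finset.mem_product] at hb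
  exact wrapped_hX Mv μ m t b.1 hb.1

/-- **THE FOUR TORUS-SIDE ROWS `d0T / d1T / d1×T / d2×T` FOR THE LABELLED BLOCK INSTANCE** —
`VectorTailsPt.wall_rows_mod` applied to: base points `(b, ℓ) ∈ [0,n)⁴ × S`, the instance map
`X₀L` (= `castT` of the integer point), the cyclic labelled shift `lshift n μ`, label-dependent
components `kk n (b, ℓ) = k ℓ`, `nn n (b, ℓ) = ν₀ ℓ`, any admissible functional `φ`; in the binder
shapes of the an4 seam (`Beta/WallVolumeTransfer`) with `GT := VectorTailsPt.GT Mv a ha (X₀L Mv)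
(fun _ b => k b.2) (fun _ b => ν₀ b.2) φ`, `Bset := lblock S`, `sh := fun n => lshift n μ` — for
which the consumer's `hshB` is `lshift_mem_lblock_iff`.  [folklore] -/
theorem rows_block
    (h12 : B5.Prop12Printed (fam (fun i : ℕ+ × τ => ((i.1 : ℕ+) : ℕ)) (fun i => i.1.pos) Mv a ha))
    (h126 : B5.Kernel126_127Printed (kfam (fun i : ℕ+ × τ => ((i.1 : ℕ+) : ℕ)) Mv))
    {l : Filter τ} (hgrow : ∀ (m : ℕ+) (ρ : Fin 4), Tendsto (fun t => (m : ℕ) * Mv (m, t) ρ) l atTop)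
    (S : Finset L) (k ν₀ : L → Fin 4) (φ : ℂ →+ ℝ) (hφ : ∀ z, |φ z| ≤ ‖z‖) (μ ν : Fin 4) :
    ∃ (δ : ℝ) (A : ℕ → ℝ), 0 < δ ∧ (∀ j, 0 ≤ A j) ∧
      (∀ n : ℕ, 2 ≤ n → ∀ b ∈ lblock S n, ∀ v : DyadicShell.Pt, v ≠ 0 → ∀ᶠ t in l,
        |GT Mv a ha (X₀L Mv) (fun _ b => k b.2) (fun _ b => ν₀ b.2) φ n b t v| ≤
          A 0 * Real.exp (-(δ / n) * DyadicShell.supNorm v) / (DyadicShell.supNorm v : ℝ) ^ 2) ∧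
      (∀ n : ℕ, 2 ≤ n → ∀ b ∈ lblock S n, ∀ v : DyadicShell.Pt, v ≠ 0 → ∀ ρ : Fin 4, ∀ᶠ t in l,
        |GT Mv a ha (X₀L Mv) (fun _ b => k b.2) (fun _ b => ν₀ b.2) φ n b t
              (v + BubbleTransfer.unitVec ρ) -
            GT Mv a ha (X₀L Mv) (fun _ b => k b.2) (fun _ b => ν₀ b.2) φ n b t v| ≤
          A 1 * Real.exp (-(δ / n) * DyadicShell.supNorm v) / (DyadicShell.supNorm v : ℝ) ^ 3) ∧
      (∀ n : ℕ, 2 ≤ n → ∀ b ∈ lblock S n, ∀ v : DyadicShell.Pt, v ≠ 0 → ∀ᶠ t in l,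
        |GT Mv a ha (X₀L Mv) (fun _ b => k b.2) (fun _ b => ν₀ b.2) φ n (lshift n μ b) t v -
            GT Mv a ha (X₀L Mv) (fun _ b => k b.2) (fun _ b => ν₀ b.2) φ n b t v| ≤
          A 3 * Real.exp (-(δ / n) * DyadicShell.supNorm v) / (DyadicShell.supNorm v : ℝ) ^ 3) ∧
      (∀ n : ℕ, 2 ≤ n → ∀ b ∈ lblock S n, ∀ v : DyadicShell.Pt, v ≠ 0 → ∀ᶠ t in l,
        |GT Mv a ha (X₀L Mv) (fun _ b => k b.2) (fun _ b => ν₀ b.2) φ n b t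
              (v + BubbleTransfer.unitVec μ + BubbleTransfer.unitVec ν) -
            GT Mv a ha (X₀L Mv) (fun _ b => k b.2) (fun _ b => ν₀ b.2) φ n b t
              (v + BubbleTransfer.unitVec μ) -
            (GT Mv a ha (X₀L Mv) (fun _ b => k b.2) (fun _ b => ν₀ b.2) φ n (lshift n μ b) t
                (v + BubbleTransfer.unitVec ν) -
              GT Mv a ha (X₀L Mv) (fun _ b => k b.2) (fun _ b => ν₀ b.2) φ n (lshift n μ b) t v)| ≤
          A 2 * Real.exp (-(δ / n) * DyadicShell.supNorm v) / (DyadicShell.supNorm v : ℝ) ^ 4) :=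
  wall_rows_mod Mv a ha h12 h126 hgrow (X₀L Mv) (fun _ b => k b.2) (fun _ b => ν₀ b.2) φ hφ
    (lblock S) (fun n => lshift n μ) (lwrapped_hX Mv S μ) (fun _ _ _ => rfl) (fun _ _ _ => rfl)

end Discharge

end

end Literature.MathematicalPhysics.QuantumFieldTheory.Balaban1983to89.Beta.VectorTailsBlock
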